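/-
COR-CM (cell pub-hodgecm2) — RSCONJ («`RecordSystem.exists_conj`», IDENT-LEMMA component (e) «SPACE by construction»; coordinator 04:22Z,
PLANNER-A RSCONJ TABLE HOME∕INBOX l.14934), row A modulo the complex side.  Pen prover-pub-hodgecm2-mukey-p6-g1-0 (RSCONJ lead).
Imports `HComp/RecordSystemConjRecip` (F3 + descent) and wb-10's global class-field conjugation facts.  KERNEL: one definition by
explicit formula (`conjModels`) + theorems (explicit binders, no `variable (h : …)`, no notation, no instance, no named fact, no `sorry`).
HC_CM is NOT proved; HELD — WORLD = C FINAL; this file discharges no END binder.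
-/
import Summits.HodgeConjecture.CorCM.B01.Transposition.HComp.RecordSystemConjRecip
import Literature.NumberTheory.GaloisRepresentations.GlobalClassFieldConjugateProofs
import Literature.NumberTheory.GaloisRepresentations.GlobalArtinMapGaloisEquivarianceProofs
import HarnessLib

/-!
# RSCONJ row A modulo the complex side: `conjModels` and `exists_conj_of_complexSide`

* `isArtinCorrespondent_conj` (RSCONJ row F3(iii), pen mukey-p5; the Literature statement is wb-10's
  `Literature/NumberTheory/GaloisRepresentations/GlobalArtinMapThetaGaloisEquivarianceProofs`): `art_L(s)|_{L^ab} = σ|_{L^ab} ⟹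
  art_L(c s)|_{L^ab} = (conj ∘ σ ∘ conj)|_{L^ab}` — functoriality of the global Artin map under `c ∈ Aut(L)` plus `τ ∘ c = conj ∘ τ`;
  `isArtinCorrespondent_conj_map` is the `Units.map (adeleConj L)` ∕ `conjAlgEquiv` currency consumed by `recip_conj`.
* `conjModels R : K' ↦ M_{c⁻¹K'} ⊗_{L,c} L` (smooth and projective by base change);
* `exists_conj_of_complexSide` — given a complex record system `Sc'` of the conjugate datum, a form `e : conjModels R ⊗_τ ℂ ≅ Sc'.Mc`
  and point transports `Θ K'` with (E) and (P), `conjModels R` is the model functor of a Deligne record system of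
  `(cH, τ, T̄, cK₀)` (`recordSystem_exists_of_descent` + `recip_conj` + `isArtinCorrespondent_conj_map`).

References: [Deligne1979ShimuraVarieties] 2.2.4–2.2.5; [Milne2005ShimuraVarieties] §12 (62); [MilneCFT] V.5.
-/

set_option autoImplicit false

noncomputable section

open CategoryTheory AlgebraicGeometry NumberField IsDedekindDomain Matrix
open Literature.AlgebraicGeometry.Motives
open Literature.NumberTheory.Automorphic.Liu2021.AppendixC (C5.OpenCompactSubgroup C5.SmallLevel)

universe u

namespace Summit.HodgeConjecture.CorCM.Model.RecordSystemConj

section ArtinPart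

open Literature.NumberTheory.GaloisRepresentations
open Literature.NumberTheory.Automorphic Literature.NumberTheory.Automorphic.UnitaryGroup
open Literature.AlgebraicGeometry.ShimuraVarieties.UnitaryCanonicalModel


/-! ## §1 Bookkeeping: restriction of `ρ⁻¹ γ ρ` to a finite subextension -/

/-- **`(ρ⁻¹ γ ρ)|_M = a` when `γ ∘ ρ = ρ ∘ a` on `M`.**  For a tower `K ⊆ K' ⊆ K̄'` (`K'|K` normal), `ρ ∈ Aut_K(K̄')`,
`γ ∈ Aut_{K'}(K̄')`, a normal subextension `M` of `K̄'|K'` and `a ∈ G(M|K')`: if `γ (ρ m) = ρ (a m)` for every `m ∈ M` (i.e. `γ`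
restricts on the conjugate field `ρM` to `ρ a ρ⁻¹`), then `ρ⁻¹ γ ρ` (the tree's `conjRestrict ρ.symm γ`) restricts on `M` to `a`.
[folklore] -/
theorem restrictNormal_conjRestrict_symm_eq {K : Type} [Field K] {K' : Type} [Field K'] [Algebra K K']
    [Normal K K'] (ρ : AlgebraicClosure K' ≃ₐ[K] AlgebraicClosure K')
    (γ : AlgebraicClosure K' ≃ₐ[K'] AlgebraicClosure K')
    (M : IntermediateField K' (AlgebraicClosure K')) [Normal K' M] (a : M ≃ₐ[K'] M)
    (h : ∀ m : M, γ (ρ (m : AlgebraicClosure K')) = ρ ((a m : M) : AlgebraicClosure K')) :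
    AlgEquiv.restrictNormal (conjRestrict ρ.symm γ) M = a := by
  apply AlgEquiv.ext
  intro m
  apply (algebraMap M (AlgebraicClosure K')).injective
  rw [AlgEquiv.restrictNormal_commutes, conjRestrict_apply, AlgEquiv.symm_symm]
  change ρ.symm (γ (ρ (m : AlgebraicClosure K'))) = ((a m : M) : AlgebraicClosure K')
  rw [h, AlgEquiv.symm_apply_apply]

/-! ## §2 Bookkeeping: the finite idèle `(c ⊗ 1) s` inside `𝕀_L` -/

/-- **`[1_∞, (c ⊗ 1) s] = c • [1_∞, s]`** in the idèle group `𝕀_L = (𝔸_L)ˣ`: the Galois action on `𝔸_L = L_∞ × 𝔸_L^∞` is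
componentwise (`AdeleRing.smul_mk`) and fixes `1_∞`. [folklore] -/
theorem inr_conjFiniteAdele_eq_smul (L : Type) [Field L] [NumberField L] [IsCMField L]
    (s s' : (FiniteAdeleRing (𝓞 L) L)ˣ)
    (hs' : (s' : FiniteAdeleRing (𝓞 L) L) =
      conjFiniteAdele ↥(maximalRealSubfield L) L (IsCMField.complexConj L) (s : FiniteAdeleRing (𝓞 L) L))
    (y y' : ideleGroup L)
    (hy : y = Units.map ((MonoidHom.inr (InfiniteAdeleRing L) (FiniteAdeleRing (𝓞 L) L) :
        FiniteAdeleRing (𝓞 L) L →* AdeleRing (𝓞 L) L)) s)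
    (hy' : y' = Units.map ((MonoidHom.inr (InfiniteAdeleRing L) (FiniteAdeleRing (𝓞 L) L) :
        FiniteAdeleRing (𝓞 L) L →* AdeleRing (𝓞 L) L)) s') :
    (IsCMField.complexConj L : L ≃ₐ[↥(maximalRealSubfield L)] L) • y = y' := by
  subst hy hy'
  apply Units.ext
  rw [AdeleRing.coe_smul_units, Units.coe_map, Units.coe_map]
  change (IsCMField.complexConj L : L ≃ₐ[↥(maximalRealSubfield L)] L) •
      (((1 : InfiniteAdeleRing L), (s : FiniteAdeleRing (𝓞 L) L)) : AdeleRing (𝓞 L) L) =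
    (((1 : InfiniteAdeleRing L), (s' : FiniteAdeleRing (𝓞 L) L)) : AdeleRing (𝓞 L) L)
  rw [AdeleRing.smul_mk, smul_one, hs', conjFiniteAdele_apply]

/-! ## §3 The transport -/

/-- **The Artin correspondence is transported by complex conjugation** ([CasselsFrohlichANT1967] VII Thm. 11.5 at the
limit).  `L` a CM field with complex conjugation `c` over `L⁺`, `τ : L →+* ℂ`, finite idèles `s`, `s'` with `s' = (c ⊗ 1) s`,
and `σ, σ' ∈ Aut(ℂ)` with `σ' = conj ∘ σ ∘ conj` (pointwise): `IsArtinCorrespondent L τ s σ → IsArtinCorrespondent L τ s' σ'`.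
Witnesses: `e' := conj ∘ e ∘ ρ` and `γ' := ρ⁻¹ γ ρ` for an extension `ρ ∈ Aut_{L⁺}(L̄)` of `c` (`AlgEquiv.liftNormal`); the class
identity `[γ'] = θ_L([1_∞, s'])⁻¹` is checked on every finite abelian `M ⊆ L̄` (`absGaloisAbProj_eq_theta_iff`) by Tate VII 11.5
on the conjugate class field `ρM` (`artinIdeleMap_conjField`), using `c⁻¹ = c`.
[cite: CasselsFrohlichANT1967, Ch. VII Thm. 11.5 (PDF p. 236)] [cite: Milne2005ShimuraVarieties, (59) p. 107 and (62) p. 114] -/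
theorem isArtinCorrespondent_conj (L : Type) [Field L] [NumberField L] [IsCMField L] (τ : L →+* ℂ)
    (s s' : (FiniteAdeleRing (𝓞 L) L)ˣ) (σ σ' : ℂ ≃+* ℂ)
    (hs' : (s' : FiniteAdeleRing (𝓞 L) L) =
      conjFiniteAdele ↥(maximalRealSubfield L) L (IsCMField.complexConj L) (s : FiniteAdeleRing (𝓞 L) L))
    (hσ' : ∀ z : ℂ, σ' z = starRingEnd ℂ (σ (starRingEnd ℂ z)))
    (h : IsArtinCorrespondent L τ s σ) : IsArtinCorrespondent L τ s' σ' := by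
  letI : Algebra L ℂ := τ.toAlgebra
  obtain ⟨e, γ, heγ, hγ⟩ := h
  -- notation
  set c : L ≃ₐ[↥(maximalRealSubfield L)] L := IsCMField.complexConj L with hc_def
  -- an extension `ρ` of `c` to `L̄`, over `L⁺`
  haveI : IsAlgClosure ↥(maximalRealSubfield L) (AlgebraicClosure L) :=
    IsAlgClosure.ofAlgebraic ↥(maximalRealSubfield L) L (AlgebraicClosure L)
  let ρ : AlgebraicClosure L ≃ₐ[↥(maximalRealSubfield L)] AlgebraicClosure L := c.liftNormal (AlgebraicClosure L)
  have hρL : ∀ x : L, ρ (algebraMap L (AlgebraicClosure L) x) = algebraMap L (AlgebraicClosure L) (c x) :=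
    fun x => c.liftNormal_commutes (AlgebraicClosure L) x
  have hρres : ρ.restrictNormal L = c := by
    apply AlgEquiv.ext
    intro x
    apply (algebraMap L (AlgebraicClosure L)).injective
    rw [AlgEquiv.restrictNormal_commutes, hρL]
  have hcc : c * c = 1 := by
    apply AlgEquiv.ext
    intro x
    exact NumberField.IsCMField.complexConj_apply_apply L x
  have hcinv : c⁻¹ = c := inv_eq_of_mul_eq_one_right hcc
  -- the conjugated Galois element `γ' = ρ⁻¹ γ ρ` (an `L`-automorphism since `ρ|_L = c` normalises `L`)
  let γA : AlgebraicClosure L ≃ₐ[L] AlgebraicClosure L := Field.absoluteGaloisGroup.toAlgEquiv L γ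
  let γ'A : AlgebraicClosure L ≃ₐ[L] AlgebraicClosure L := conjRestrict ρ.symm γA
  let γ' : Field.absoluteGaloisGroup L := (Field.absoluteGaloisGroup.toAlgEquiv L).symm γ'A
  -- the conjugate embedding `e' = conj ∘ e ∘ ρ`, an `L`-algebra map along `τ` since `τ ∘ c = conj ∘ τ`
  let e' : AlgebraicClosure L →ₐ[L] ℂ :=
    { toRingHom := ((starRingEnd ℂ : ℂ →+* ℂ).comp (e : AlgebraicClosure L →+* ℂ)).comp
        (ρ : AlgebraicClosure L →+* AlgebraicClosure L)
      commutes' := fun x => by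
        change starRingEnd ℂ (e (ρ (algebraMap L (AlgebraicClosure L) x))) = algebraMap L ℂ x
        rw [hρL, AlgHom.commutes]
        change starRingEnd ℂ (τ (c x)) = τ x
        rw [hc_def, NumberField.IsCMField.complexEmbedding_complexConj, starRingEnd_self_apply] }
  refine ⟨e', γ', fun x => ?_, ?_⟩
  · -- `e' (γ' x) = σ' (e' x)`
    change starRingEnd ℂ (e (ρ (ρ.symm (γA (ρ.symm.symm x))))) = σ' (starRingEnd ℂ (e (ρ x)))
    rw [AlgEquiv.apply_symm_apply, AlgEquiv.symm_symm, hσ', starRingEnd_self_apply]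
    exact congrArg (starRingEnd ℂ) (heγ (ρ x))
  · -- `[γ'] = θ_L([1_∞, s'])⁻¹`, checked on every finite abelian `M`
    rw [← map_inv] at hγ ⊢
    rw [(isGlobalReciprocitySystem_artinMap L).toIsCompatibleSystem.absGaloisAbProj_eq_theta_iff] at hγ ⊢
    intro M hMfin hMab
    haveI : NumberField M := NumberField.of_module_finite L M
    haveI : Normal L (conjField ρ M) := normal_conjField ρ M
    -- the finite idèles inside `𝕀_L`
    set y : ideleGroup L := Units.map ((MonoidHom.inr (InfiniteAdeleRing L) (FiniteAdeleRing (𝓞 L) L) :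
        FiniteAdeleRing (𝓞 L) L →* AdeleRing (𝓞 L) L)) s with hy_def
    set y' : ideleGroup L := Units.map ((MonoidHom.inr (InfiniteAdeleRing L) (FiniteAdeleRing (𝓞 L) L) :
        FiniteAdeleRing (𝓞 L) L →* AdeleRing (𝓞 L) L)) s' with hy'_def
    have hy' : (ρ.restrictNormal L)⁻¹ • y⁻¹ = y'⁻¹ := by
      rw [hρres, hcinv, smul_inv', inr_conjFiniteAdele_eq_smul L s s' hs' y y' hy_def hy'_def]
    -- Tate VII 11.5 on the conjugate class field `ρM`: `γ|_{ρM} = ρ ψ_{M|L}(c • y⁻¹) ρ⁻¹ = ρ ψ_{M|L}(y'⁻¹) ρ⁻¹`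
    have hγM := hγ (conjField ρ M)
    rw [artinMapFamily_eq, finiteIdeleClass, ← QuotientGroup.mk_inv, artinClassMap_mk,
      artinIdeleMap_conjField M artinReciprocity_character_holds ρ] at hγM
    change AlgEquiv.restrictNormal γA (conjField ρ M) =
      semilinearConj (conjFieldEquiv ρ M) (ρ.restrictNormal L) (conjFieldEquiv_semilinear ρ M)
        (artinIdeleMap M artinReciprocity_character_holds ((ρ.restrictNormal L)⁻¹ • y⁻¹)) at hγM
    rw [hy'] at hγM
    -- pointwise on `K̄`: `γ (ρ m) = ρ (ψ_{M|L}(y'⁻¹) m)`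
    have hpt : ∀ m : M, γA (ρ (m : AlgebraicClosure L)) =
        ρ (((artinIdeleMap M artinReciprocity_character_holds (y'⁻¹)) m : M) : AlgebraicClosure L) := by
      intro m
      have h1 := AlgEquiv.restrictNormal_apply (conjField ρ M) γA (conjFieldEquiv ρ M m)
      rw [hγM, semilinearConj_apply, RingEquiv.symm_apply_apply] at h1
      -- `h1 : ((conjFieldEquiv ρ M) (ψ m) : K̄) = γA ((conjFieldEquiv ρ M m : K̄))`, both coercions are `ρ (·)`
      exact h1.symm
    -- transport back to `M`
    rw [artinMapFamily_eq, finiteIdeleClass, ← QuotientGroup.mk_inv, artinClassMap_mk]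
    change AlgEquiv.restrictNormal ((Field.absoluteGaloisGroup.toAlgEquiv L)
      ((Field.absoluteGaloisGroup.toAlgEquiv L).symm γ'A)) M = artinIdeleMap M artinReciprocity_character_holds y'⁻¹
    rw [MulEquiv.apply_symm_apply]
    exact restrictNormal_conjRestrict_symm_eq ρ γA M _ hpt

/-- **The same at the literal conjugates** `s' := Units.map (c ⊗ 1) s` and `σ' := conj ∘ σ ∘ conj`
(`(starRingAut.trans σ).trans starRingAut`). [cite: CasselsFrohlichANT1967, Ch. VII Thm. 11.5 (PDF p. 236)] -/
theorem isArtinCorrespondent_conj_map (L : Type) [Field L] [NumberField L] [IsCMField L] (τ : L →+* ℂ)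
    (s : (FiniteAdeleRing (𝓞 L) L)ˣ) (σ : ℂ ≃+* ℂ) (h : IsArtinCorrespondent L τ s σ) :
    IsArtinCorrespondent L τ
      (Units.map (conjFiniteAdele ↥(maximalRealSubfield L) L (IsCMField.complexConj L) :
        FiniteAdeleRing (𝓞 L) L →* FiniteAdeleRing (𝓞 L) L) s)
      (((starRingAut : ℂ ≃+* ℂ).trans σ).trans (starRingAut : ℂ ≃+* ℂ)) :=
  isArtinCorrespondent_conj L τ s _ σ _ rfl (fun _ => rfl) h

/-- **`IsArtinCorrespondent` is INVARIANT under `(s, σ) ↦ ((c ⊗ 1) s, conj ∘ σ ∘ conj)`** (the transport is an involution: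
`c ∘ c = 1`, `conj ∘ conj = 1`), the `↔` form for consumers that start from the conjugate side.
[cite: CasselsFrohlichANT1967, Ch. VII Thm. 11.5 (PDF p. 236)] -/
theorem isArtinCorrespondent_conj_iff (L : Type) [Field L] [NumberField L] [IsCMField L] (τ : L →+* ℂ)
    (s s' : (FiniteAdeleRing (𝓞 L) L)ˣ) (σ σ' : ℂ ≃+* ℂ)
    (hs' : (s' : FiniteAdeleRing (𝓞 L) L) =
      conjFiniteAdele ↥(maximalRealSubfield L) L (IsCMField.complexConj L) (s : FiniteAdeleRing (𝓞 L) L))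
    (hσ' : ∀ z : ℂ, σ' z = starRingEnd ℂ (σ (starRingEnd ℂ z))) :
    IsArtinCorrespondent L τ s σ ↔ IsArtinCorrespondent L τ s' σ' := by
  refine ⟨isArtinCorrespondent_conj L τ s s' σ σ' hs' hσ', fun h => isArtinCorrespondent_conj L τ s' s σ' σ ?_ ?_ h⟩
  · -- `s = (c ⊗ 1) s'` since `c ∘ c = 1`
    have hcc : (IsCMField.complexConj L : L ≃ₐ[↥(maximalRealSubfield L)] L) * IsCMField.complexConj L = 1 :=
      AlgEquiv.ext fun x => NumberField.IsCMField.complexConj_apply_apply L x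
    rw [hs', conjFiniteAdele_apply, conjFiniteAdele_apply, ← mul_smul, hcc, one_smul]
  · intro z
    rw [hσ', starRingEnd_self_apply, starRingEnd_self_apply]

end ArtinPart

/-! ## ROW A (part 2): the assembly MODULO THE COMPLEX SIDE — `exists_conj_of_complexSide`

Given a record system `R` of `(H, τ, T, K₀)`, its conjugate MODEL system is `conjModels R : K' ↦ M_{c⁻¹K'} ⊗_{L,c} L`.  If the
complex side is supplied — a complex record system `Sc'` of the conjugate datum `(c H, τ, T̄, c K₀)`, the «form» isomorphism
`e : conjModels R ⋙ (· ⊗_{L,τ} ℂ) ≅ Sc'.Mc`, and a point transport `Θ K' : (M_{c⁻¹K'} ⊗_c L)(ℂ)_τ ≃ M_{c⁻¹K'}(ℂ)_τ` which is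
(E) `σ ↦ conj ∘ σ ∘ conj`-equivariant and (P) matches the points read through `e` and `Sc'.pts` with `[x, a]′ ↦ pts⁻¹[x̄, (c ⊗ 1)⁻¹ a]`
(RSCONJ rows F2a∕F2b∕F2c) — then `conjModels R` IS a Deligne record system of the conjugate datum: smoothness∕projectivity by base
change, the complex clauses by descent (`recordSystem_exists_of_descent`), reciprocity by `recip_conj` + `isArtinCorrespondent_conj`. -/

section Assembly

open Literature.AlgebraicGeometry.ShimuraVarieties Literature.AlgebraicGeometry.ShimuraVarieties.UnitaryCanonicalModel
open Literature.NumberTheory.Automorphic Literature.NumberTheory.Automorphic.UnitaryGroup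
open Literature.Geometry.ComplexHyperbolic Literature.Geometry.ComplexHyperbolic.BallModel
open Summit.HodgeConjecture.CorCM.D2Bridge.UnitaryGroupConj

variable {L : Type} [Field L] [NumberField L] [IsCMField L] {H : Matrix (Fin 3) (Fin 3) L} {τ : L →+* ℂ} {T : GL (Fin 3) ℂ}
  {hT : formCongr (starRingEnd ℂ) T (H.map τ) = BallModel.J}
  {K₀ : C5.OpenCompactSubgroup ↥(finAdelic (↥(maximalRealSubfield L)) L (IsCMField.complexConj L) 3 H)}

/-- **The conjugate MODEL system** `K' ↦ M_{c⁻¹K'} ⊗_{L,c} L` of a record system (= `Model.conjSystem` of `HComp/HonestP5.lean` :177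
re-indexed by the levels of `U(cH)`). [cite: Liu2021, Prop. C.5 (FJcycle.tex l. 4627–4637)] -/
def conjModels (R : RecordSystem L H τ T hT K₀) : C5.SmallLevel (conjLevel₀ L H K₀) ⥤ SchemeOver L :=
  smallLevelConjBack L H K₀ ⋙ R.M ⋙
    Literature.AlgebraicGeometry.Motives.baseChangeHom ((IsCMField.complexConj L : L ≃ₐ[↥(maximalRealSubfield L)] L) : L →+* L)

/-- unfolding: `(conjModels R) K' = M_{c⁻¹K'} ⊗_{L,c} L`. [folklore] -/
@[simp] theorem conjModels_obj (R : RecordSystem L H τ T hT K₀) (K' : C5.SmallLevel (conjLevel₀ L H K₀)) :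
    (conjModels R).obj K' =
      (Literature.AlgebraicGeometry.Motives.baseChangeHom
          ((IsCMField.complexConj L : L ≃ₐ[↥(maximalRealSubfield L)] L) : L →+* L)).obj
        (R.M.obj ((smallLevelConjBack L H K₀).obj K')) := rfl

/-- `M_{c⁻¹K'} ⊗_{L,c} L` is smooth of relative dimension `2` (base change). [folklore] -/
theorem smooth_conjModels (R : RecordSystem L H τ T hT K₀) (K' : C5.SmallLevel (conjLevel₀ L H K₀)) :
    AlgebraicGeometry.SmoothOfRelativeDimension 2 ((conjModels R).obj K').hom := by
  have := AlgebraicGeometry.smoothOfRelativeDimension_isStableUnderBaseChange 2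
  exact MorphismProperty.pullback_snd (P := @AlgebraicGeometry.SmoothOfRelativeDimension 2) _ _ (R.smooth _)

/-- `M_{c⁻¹K'} ⊗_{L,c} L` is projective over `L` (base change). [folklore] -/
theorem projective_conjModels (R : RecordSystem L H τ T hT K₀) (K' : C5.SmallLevel (conjLevel₀ L H K₀)) :
    IsProjectiveOver ((conjModels R).obj K') :=
  letI : Algebra L L := (((IsCMField.complexConj L : L ≃ₐ[↥(maximalRealSubfield L)] L) : L →+* L)).toAlgebra
  (R.projective ((smallLevelConjBack L H K₀).obj K')).baseChange_obj L

set_option maxHeartbeats 1600000 in -- large adelic / Shimura-set terms, as in `recordSystem_exists_of_descent`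
/-- **RSCONJ row A modulo the complex side**: `conjModels R` is a Deligne record system of `(c H, τ, T̄, c K₀)` as soon as rows F2a∕F2b∕F2c
supply a complex record system `Sc'` of that datum with the form `e : conjModels R ⊗_τ ℂ ≅ Sc'.Mc` and a point transport `Θ` satisfying
(E) and (P).  The arithmetic clause (F3, Shimura reciprocity at the diagonal special pairs) is DISCHARGED here from `R.recip` by
`recip_conj` and mukey-p5's `isArtinCorrespondent_conj`. [cite: Deligne1979ShimuraVarieties, 2.2.4–2.2.5]
[cite: Milne2005ShimuraVarieties, Def. 12.8 (62) p. 114] -/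
theorem exists_conj_of_complexSide (R : RecordSystem L H τ T hT K₀)
    (Sc' : ComplexRecordSystem L (conjGram L H) τ (conjFrame T) (formCongr_conjFrame L H τ T hT) (conjLevel₀ L H K₀))
    (e : (conjModels R ⋙ Literature.AlgebraicGeometry.Motives.baseChangeHom τ) ≅ Sc'.Mc)
    (Θ : letI : Algebra L ℂ := τ.toAlgebra
      ∀ K' : C5.SmallLevel (conjLevel₀ L H K₀),
        ComplexPoints ((conjModels R).obj K') ≃ ComplexPoints (R.M.obj ((smallLevelConjBack L H K₀).obj K')))
    (hE : letI : Algebra L ℂ := τ.toAlgebra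
      ∀ (K' : C5.SmallLevel (conjLevel₀ L H K₀)) (σ : ℂ ≃ₐ[L] ℂ) (P : ComplexPoints ((conjModels R).obj K')),
        Θ K' (σ • P) = conjAlgEquiv τ σ • Θ K' P)
    (hP : letI : Algebra L ℂ := τ.toAlgebra
      ∀ (K' : C5.SmallLevel (conjLevel₀ L H K₀)) (x : Ball)
        (a : finAdelic (↥(maximalRealSubfield L)) L (IsCMField.complexConj L) 3 (conjGram L H)),
        (AlgPoints.baseChangeEquiv τ ((conjModels R).obj K')).symm
            (AlgPoints.map (e.inv.app K')
              ((Sc'.pts K').symm (ShimuraSet.mk L (conjGram L H) τ (conjFrame T) (formCongr_conjFrame L H τ T hT) K'.1.1 x a))) =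
          (Θ K').symm ((R.pts ((smallLevelConjBack L H K₀).obj K')).symm
            (ShimuraSet.mk L H τ T hT ((smallLevelConjBack L H K₀).obj K').1.1 (conjBall x) ((groupConj L H).symm a)))) :
    ∃ R' : RecordSystem L (conjGram L H) τ (conjFrame T) (formCongr_conjFrame L H τ T hT) (conjLevel₀ L H K₀),
      R'.M = conjModels R := by
  letI : Algebra L ℂ := τ.toAlgebra
  refine recordSystem_exists_of_descent Sc' (conjModels R) (smooth_conjModels R) (projective_conjModels R) e ?_
  intro K' σ s hs v₃ x hx d hd a
  exact recip_conj L H τ T hT ((smallLevelConjBack L H K₀).obj K').1.1 K'.1.1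
    (R.M.obj ((smallLevelConjBack L H K₀).obj K')) ((conjModels R).obj K')
    (R.pts ((smallLevelConjBack L H K₀).obj K'))
    (fun Q => (AlgPoints.baseChangeEquiv τ ((conjModels R).obj K')).symm (AlgPoints.map (e.inv.app K') ((Sc'.pts K').symm Q)))
    (R.recip ((smallLevelConjBack L H K₀).obj K')) (Θ K') (hE K') (hP K')
    (fun s' σ' h' => isArtinCorrespondent_conj L τ s' _ σ'.toRingEquiv _ rfl (fun _ => rfl) h')
    σ s hs v₃ x hx d hd a

end Assembly

end Summit.HodgeConjecture.CorCM.Model.RecordSystemConj
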